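import Summits.AnomalousDissipation.AnomalousDissipation.Theses.PointSink
import Summits.AnomalousDissipation.AnomalousDissipation.Theorems.PointSinkPointFluxCone
import Summits.AnomalousDissipation.AnomalousDissipation.Theorems.ConeDesingularisation.Negative.LiouvilleReduction
import Literature.Analysis.FluidPDE.SteadyNSLiouville
import Literature.Analysis.FluidPDE.SteadyDSolutionAsymptotics

/-!
# `ConeDesingularisation` (stmt-AnomalousDissipation-19034, route PointSink) COLLAPSES TO ITS NODE and is
# false modulo the Liouville conjecture — negative lemma (line lead, cycle 2)

The crux is literally `PointFluxCone → CascadeSoliton` (`Negative.crux_iff`, `Iff.rfl`): its conclusion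
re-quantifies the far field, untied to the hypothesis' cone. On 2026-08-17T14:16Z the rank-2 sibling crux
`PointFluxCone` (stmt-AnomalousDissipation-19033) was PROVED
(`Summit.AnomalousDissipation.AnomalousDissipation.Theorems.PointFluxCone_of`, a dilation-periodised
Choffrut–Székelyhidi wild box; by its own account the witness carries no energy flux between shells — the
non-zero "flux log-mean" is a bulk Duchon–Robert roughness moment). Hence, kernel-checked here:

* `coneDesingularisation_iff_cascadeSoliton` — the crux is now UNCONDITIONALLY EQUIVALENT to the support node
  `CascadeSoliton` (stmt-AnomalousDissipation-19036): a smooth steady unforced unit-viscosity Navier–Stokes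
  solution on `ℝ³` with the `R^{5/3}` mass envelope, `0 < ∫|∇Q|² < ∞` and a non-trivial (−2/3)-DSS shell-`L²`
  far field — i.e. a counterexample to Galdi's Liouville problem for steady `D`-solutions in the critical
  `L²`-mass class. Every seat on 19034 is a seat on 19036 and conversely.
* `ConeDesingularisation_false_of_SteadyDSolutionLiouvilleProblem` — under the OPEN Liouville conjecture for
  steady `D`-solutions (`Literature.Analysis.FluidPDE.SteadyDSolutionLiouvilleProblem`, Galdi 2011 p. 12 /
  Remark X.9.4, Tsai 2018 Conj. 2.5, Wang 2025 p. 1, Wang–Yang 2026: `[status: open]`) together with Galdi's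
  Thm X.5.1 in the printed form of Wang 2025, Remark 2.1 (`wang2025_rem21_DSolution_tendsto_const`: every
  `D`-solution tends to some constant at infinity — a PUBLISHED theorem, vendored as a named fact, p140773)
  the crux is FALSE: compose the landed `Negative.not_cascadeSoliton_of_liouville` (p163677) with
  `PointFluxCone_of`. This is the planner's kill criterion (k2) with its first conjunct discharged: what
  separates the crux from a refutation is exactly the Liouville conjecture (plus the published X.5.1).
* `not_liouville_of_coneDesingularisation` — contrapositive reading for allocation: ANY proof of the crux
  is (given X.5.1) a disproof of the Liouville conjecture for steady `D`-solutions on `ℝ³`.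

`H = SteadyDSolutionLiouvilleProblem` is not constructible here: it is the open problem itself (consensus
expects it to hold; every printed criterion — Galdi X.9.5 `L^{9/2}`, Seregin–Wang 2020, Tsai 2021, KPR 2015,
Wang–Yang 2026 `r^{-2/3}log^{-γ}`, `γ > 1/3` — stops strictly inside the soliton's decay class; see
`Negative/LpEscape.lean`, `Negative/FarFieldMass.lean`). Nothing in this file asserts a Theses decl.
-/

noncomputable section

-- `Summit.<Summit>.<Problem>`: single-conjunct summit, the duplicate namespace is mandated (CONVENTIONS §2).
set_option linter.dupNamespace false

open Literature.Analysis.FluidPDE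

namespace Summit.AnomalousDissipation.AnomalousDissipation.Theorems.ConeDesingularisation.Negative

open Summit.AnomalousDissipation.AnomalousDissipation.Theses.PointSink
  (PointFluxCone ConeDesingularisation CascadeSoliton)
open Summit.AnomalousDissipation.AnomalousDissipation.Theorems (PointFluxCone_of)

/-- **The crux collapses to its node.** Since `PointFluxCone` is a theorem (`PointFluxCone_of`) and the
conclusion of `ConeDesingularisation` re-quantifies the far field, the crux is equivalent to the support
node `CascadeSoliton` (stmt-AnomalousDissipation-19036) outright. [folklore] -/
theorem coneDesingularisation_iff_cascadeSoliton : ConeDesingularisation ↔ CascadeSoliton :=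
  ⟨fun h => h PointFluxCone_of, fun h _ => h⟩

/-- **Negative lemma — the crux is false modulo the Liouville conjecture.** Under the open Liouville
conjecture for steady `D`-solutions on `ℝ³` (`SteadyDSolutionLiouvilleProblem`) and Galdi's Thm X.5.1 in the
form of Wang 2025, Remark 2.1 (`wang2025_rem21_DSolution_tendsto_const`, published, vendored), there is no
cascade soliton (`not_cascadeSoliton_of_liouville`), while the hypothesis `PointFluxCone` holds
(`PointFluxCone_of`); so the implication fails. Kill criterion (k2) of the route with its cone conjunct
discharged. [folklore] -/
theorem ConeDesingularisation_false_of_SteadyDSolutionLiouvilleProblem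
    (hL : SteadyDSolutionLiouvilleProblem) (hrem : wang2025_rem21_DSolution_tendsto_const) :
    ¬ ConeDesingularisation := fun h =>
  not_cascadeSoliton_of_liouville hL hrem (h PointFluxCone_of)

/-- **Contrapositive, for allocation**: given Galdi's Thm X.5.1 (Wang 2025, Remark 2.1), any proof of the
crux refutes the Liouville conjecture for steady `D`-solutions on `ℝ³`. [folklore] -/
theorem not_liouville_of_coneDesingularisation (h : ConeDesingularisation)
    (hrem : wang2025_rem21_DSolution_tendsto_const) : ¬ SteadyDSolutionLiouvilleProblem := fun hL =>
  ConeDesingularisation_false_of_SteadyDSolutionLiouvilleProblem hL hrem h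

end Summit.AnomalousDissipation.AnomalousDissipation.Theorems.ConeDesingularisation.Negative

end
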